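import Summits.CriticalPhenomena.PercolationContinuityZ3.Theorems.PercAnnulusCrossingBoxCrossingWindow
import Summits.CriticalPhenomena.PercolationContinuityZ3.Theorems.PercNearOneGluingNoHeavyRsw3SpongeCriterion
import HarnessLib

/-!
# RSW3 lane (lead, gen 24): SYMMETRY AND SHARP THRESHOLDS, XI — `ℤ³`: at `p_c + C/log n` the easy box `(n; 7n, 7n)` is crossed
# the short way with probability `≥ 1 − δ` (effective Kesten sponge crossing above `p_c(ℤ³)`)

builds on p205010 (kernel theorem, internal audit signed; external expert review pending) — NOT used in this file (the input at
`p_c(ℤ³)` is the sharpness-side sponge floor `1/5184 ≤ P_p(boxCross (easyShape 3 (2n)) 0)` for every `p ≥ p_c`, Kesten Thm 5.1).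

Cell `prim-rsw3` (LANE 3), lead seat, gen 24.  Support file (`--supports stmt-CriticalPhenomena-4575`); no definitions,
no named facts, no sorries.  Part VII's two-level window theorem for Kesten's box crossings, run from the lane's proved wall
`EasyCrossingLowerBound` (in the explicit form `Rsw3.le_real_boxCross_easyShape_three_of_criticalProb_le`): the block
`{0..2n} × {0..6n}²` crossed in direction `0` at level `1/5184` for every `p ≥ p_c(ℤ³)`, the target block shorter by `a = n`
along and wider by `n` across — `{0..n} × {0..7n}² = easyShape 7 n` — on the torus of side `9n`:

* `easyShape_three_two_mul_eq`, `easyShape_seven_eq` — the two blocks as side vectors;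
* **`real_boxCross_easyShape_seven_ge_one_sub_of_criticalProb_le`** — for every `p ≥ p_c(ℤ³)` (`0 < p`), `δ > 0` and `n` with
  `2·(9n)^{−3/4} ≤ min(1/5184, δ^{1000})`, `δ^{1000} ≤ 1/2`: **`q ≥ p + 32·(log 5184 + 1000·log(1/δ))/(3·log(9n))`, `q < 1` ⇒
  `P_q(boxCross (easyShape 7 n) 0) ≥ 1 − δ`** — Kesten's `σ((n; 7n, 7n); short; p) → 1` above `p_c` made EFFECTIVE: at
  `p_c + η` it is `≥ 1 − δ` as soon as `log(9n) ≥ C_δ/η`, with the explicit `C_δ = 32(log 5184 + 1000 log(1/δ))/3`.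

References: H. Kesten, *Percolation Theory for Mathematicians* (1982) Thm. 5.1, Cor. 5.1; B. Bollobás, O. Riordan, *Percolation*
(CUP 2006) Ch. 3 Lemma 8; E. Friedgut, G. Kalai, Proc. AMS 124 (1996) Thm. 2.1.
-/

noncomputable section

namespace Summit.CriticalPhenomena.PercolationContinuityZ3.Theorems.Crossing

open MeasureTheory Literature.Probability.LatticeModels Literature.Probability.Percolation SimpleGraph

/-- `easyShape 3 (2n) = (2n; 6n, 6n)` as an `if`-vector. [folklore] -/
theorem easyShape_three_two_mul_eq (n : ℕ) :
    easyShape 3 (2 * n) = fun j : Fin 3 => if j = 0 then ((2 * n : ℕ) : ℤ) else ((6 * n : ℕ) : ℤ) := by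
  funext j
  fin_cases j <;> simp [easyShape] <;> ring

/-- `easyShape 7 n = (n; 7n, 7n)` as an `if`-vector. [folklore] -/
theorem easyShape_seven_eq (n : ℕ) :
    easyShape 7 n = fun j : Fin 3 => if j = 0 then ((n : ℕ) : ℤ) else ((7 * n : ℕ) : ℤ) := by
  funext j
  fin_cases j <;> simp [easyShape]

/-- **EFFECTIVE SPONGE CROSSING ABOVE `p_c(ℤ³)`**: for every `p ≥ p_c(ℤ³)` with `0 < p`, every `0 < δ` and every `n ≥ 1` with
`2·(9n)^{−3/4} ≤ 1/5184`, `2·(9n)^{−3/4} ≤ δ^{10^3} ≤ 1/2`: if `q < 1` and `q ≥ p + 32·(log 5184 + 10^3·log(1/δ))/(3·log(9n))`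
then **`P_q(boxCross (easyShape 7 n) 0) ≥ 1 − δ`** — the easy block `{0..n} × {0..7n}²` is crossed the short way with probability
at least `1 − δ` already at `p_c + C_δ/log n` (the window principle of part VII started from Kesten's sponge floor
`P_p(boxCross (easyShape 3 (2n)) 0) ≥ 1/5184`, valid at every `p ≥ p_c(ℤ³)`). [cite: Kesten1982, Thm. 5.1 and Cor. 5.1]
[cite: BollobasRiordan2006, Ch. 3, Lemma 8] [cite: FriedgutKalai1996, Thm. 2.1] -/
theorem real_boxCross_easyShape_seven_ge_one_sub_of_criticalProb_le {n : ℕ} (hn : 1 ≤ n) {δ : ℝ} (hδ0 : 0 < δ)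
    (hε : 2 * (((9 * n : ℕ) : ℝ)) ^ (-((3 : ℝ) / 4)) ≤ 1 / 5184)
    (hδ : 2 * (((9 * n : ℕ) : ℝ)) ^ (-((3 : ℝ) / 4)) ≤ δ ^ ((9 + 1) ^ 3)) (hδhalf : δ ^ ((9 + 1) ^ 3) ≤ 1 / 2)
    {p q : unitInterval} (hp0 : 0 < (p : ℝ)) (hpc : criticalProb (zdGraph 3) 0 ≤ (p : ℝ)) (hq1 : (q : ℝ) < 1)
    (hwin : (p : ℝ) + 32 * (Real.log 5184 + ((9 + 1) ^ 3 : ℕ) * Real.log (1 / δ)) / (3 * Real.log ((9 * n : ℕ) : ℝ)) ≤ q) :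
    1 - δ ≤ boxCrossProb 3 q (easyShape 7 n) 0 := by
  have hstart : (1 : ℝ) / 5184 ≤ boxCrossProb 3 p (fun j : Fin 3 => if j = 0 then ((2 * n : ℕ) : ℤ) else ((6 * n : ℕ) : ℤ)) 0 := by
    rw [← easyShape_three_two_mul_eq]
    exact Rsw3.le_real_boxCross_easyShape_three_of_criticalProb_le p hpc hn
  have hlog : Real.log (1 / (1 / (5184 : ℝ))) = Real.log 5184 := by norm_num
  have h := boxCrossProb_ge_one_sub_of_le_boxCrossProb (d := 3) (by norm_num) (K := 9) (a := n) hn (by omega) (0 : Fin 3)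
    (n := fun j : Fin 3 => if j = 0 then ((2 * n : ℕ) : ℤ) else ((6 * n : ℕ) : ℤ))
    (ℓ := fun j : Fin 3 => if j = 0 then ((n : ℕ) : ℤ) else ((7 * n : ℕ) : ℤ))
    (by simp only [if_true]; exact_mod_cast hn) (by simp only [if_true]; push_cast; linarith)
    (fun j hj => by simp only [hj, if_false]; push_cast; linarith)
    (fun j => by by_cases hj : j = 0 <;> simp only [hj, if_true, if_false] <;> push_cast <;> linarith)
    (fun j => by by_cases hj : j = 0 <;> simp only [hj, if_true, if_false] <;> push_cast <;> linarith)
    hε (by norm_num) hδ0 hδ hδhalf hp0 hq1 hstart (by rw [hlog]; exact hwin)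
  rw [easyShape_seven_eq]
  exact h

end Summit.CriticalPhenomena.PercolationContinuityZ3.Theorems.Crossing

end
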